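import Literature.NumberTheory.LFunctions.XiDerivativeCriticalZerosRolle
import Literature.NumberTheory.LFunctions.XiDerivativeZeroCountingFunction
import HarnessLib

/-!
# Unconditionally, at least two thirds of the zeros of `ξ′` lie on the critical line: `κ′₁ ≥ 2/3`

RH-FREE (every statement below is an unconditional theorem of this tree; «nothing here bears on the
truth of RH»). Topic `Literature/NumberTheory/LFunctions`, namespace `Literature.NumberTheory.LFunctions`.
PROOF LAYER for `XiDerivativeZeros.lean` (Conrey 1983, J. Number Theory 16: the proportion
`κ′₁ = xiDerivCriticalLineProportion 1 = liminf_T N^{(1)}₀(T)/N^{(1)}(T)` of zeros of `ξ′` on the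
critical line): theorems only — no definitions, no named facts.

Assembly of the two sibling files:

* `XiDerivativeCriticalZerosRolle.lean`: `N^{(1)}₀(T) ≥ (2/3 − ε) N(T)` eventually (Rolle's theorem on the
  critical line applied to the simple critical zeros of `ζ` supplied by [AF26] Theorem A (i), a kernel
  theorem of this tree, `AlpogeFurman2026_simple_critical_holds`);
* `XiDerivativeZeroCountingFunction.lean`: `N^{(1)}(T) = N(T) + O(log T)` (Conrey 1983, Lemma 2 for
  `m = 1`, proved by Backlund's argument);
* and `N(T) ≥ ½ (T/2π) log T` eventually (Riemann–von Mangoldt).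

Results: `tendsto_xiDerivZeroCount_div_zetaZeroCount` (`N^{(1)}(T)/N(T) → 1`),
`eventually_two_thirds_mul_xiDerivZeroCount_le` (`(2/3 − ε) N^{(1)}(T) ≤ N^{(1)}₀(T)` eventually) and
**`two_thirds_le_xiDerivCriticalLineProportion_one : 2/3 ≤ κ′₁`** — unconditionally, at least two thirds
of the zeros of `ξ′` (counted with multiplicity, ordered by height) are on the critical line.

Status. This is WEAKER than the literature: Conrey 1983 (Corollary p. 50, Levinson's method) proves
`κ′₁ ≥ 0.8137` — the tree's named fact `conrey1983_xiDeriv_one`, which stays unproved — and [AF26]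
Remark 7.1 claims `0.85838` (`AlpogeFurman2026_xiDeriv_simple_critical_dyadic`, a claim without printed
proof). Before this file the tree had NO unconditional lower bound for `κ′₁` (only `κ′₁ = 1` under RH,
`xiDerivCriticalLineProportion_one_eq_one_of_RH`, and `0.85838` conditionally on the [AF26] claim,
`CriticalLineTwoThirdsXiDeriv.lean`). The constant `2/3` can be raised to `2 − c_MT⁻¹ = 0.6725…` by
telescoping the Montgomery–Taylor dyadic form `AlpogeFurman2026_simple_critical_MT_dyadic_holds` (not done
here). [AF26] = Alpöge–Furman, arXiv:2608.13637v2 (2026), unrefereed; its Theorem A enters only as the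
kernel theorem `AlpogeFurman2026_simple_critical_holds` (standard axioms); no endorsement beyond that.
Nothing here bears on the truth of RH.

## References

* J. B. Conrey, *Zeros of derivatives of Riemann's ξ-function on the critical line*, J. Number Theory 16
  (1983) 49–74: §1 (p. 49), Lemma 2 (p. 52), Corollary (p. 50). [key `Conrey1983`]
* L. Alpöge, K. Furman, arXiv:2608.13637v2 (2026): Theorem A (i), Remark 7.1. [key `AlpogeFurman2026`]
-/

noncomputable section

open Filter Topology

namespace Literature.NumberTheory.LFunctions

/-- **`N^{(1)}(T) ∼ N(T)`**: the zeros of `ξ′` and of `ξ` up to height `T` are equinumerous to first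
order, `N^{(1)}(T)/N(T) → 1` (`N^{(1)} − N = O(log T)` and `N(T) ≥ ½ (T/2π) log T` eventually).
[cite: Conrey1983, Lemma 2 (p. 52)] -/
theorem tendsto_xiDerivZeroCount_div_zetaZeroCount :
    Tendsto (fun T : ℝ ↦ (xiDerivZeroCount 1 T : ℝ) / zetaZeroCount T) atTop (𝓝 1) := by
  obtain ⟨C, T₀, hT₀, hC⟩ := exists_abs_xiDerivZeroCount_sub_zetaZeroCount_le_log
  have hmain := AlpogeFurman2026.eventually_zetaZeroCount_near_main (1 / 2) (by norm_num)
  -- `|N₁/N − 1| ≤ 4π|C|/T` eventually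
  have hlow : Tendsto (fun T : ℝ ↦ 1 - 4 * Real.pi * |C| * T⁻¹) atTop (𝓝 1) := by
    have := (tendsto_inv_atTop_zero.const_mul (4 * Real.pi * |C|)).const_sub 1
    simpa using this
  have hhigh : Tendsto (fun T : ℝ ↦ 1 + 4 * Real.pi * |C| * T⁻¹) atTop (𝓝 1) := by
    have := (tendsto_inv_atTop_zero.const_mul (4 * Real.pi * |C|)).const_add 1
    simpa using this
  refine tendsto_of_tendsto_of_tendsto_of_le_of_le' hlow hhigh ?_ ?_
  all_goals
    filter_upwards [eventually_ge_atTop T₀, hmain, eventually_gt_atTop (1 : ℝ)] with T hT hN hT1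
    have hπ := Real.pi_pos
    have hL : 0 < Real.log T := Real.log_pos hT1
    have hM : 0 < T / (2 * Real.pi) * Real.log T := by positivity
    have hNpos : 0 < (zetaZeroCount T : ℝ) := by linarith [hN.1]
    have hb := hC T hT
    have hb' : |(xiDerivZeroCount 1 T : ℝ) - zetaZeroCount T| ≤ |C| * Real.log T :=
      hb.trans (mul_le_mul_of_nonneg_right (le_abs_self C) hL.le)
    have hq : |(xiDerivZeroCount 1 T : ℝ) / zetaZeroCount T - 1| ≤ 4 * Real.pi * |C| * T⁻¹ := by
      rw [show (xiDerivZeroCount 1 T : ℝ) / zetaZeroCount T - 1 =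
        ((xiDerivZeroCount 1 T : ℝ) - zetaZeroCount T) / zetaZeroCount T by field_simp,
        abs_div, abs_of_pos hNpos, div_le_iff₀ hNpos]
      have hN2 : (1 - 1 / 2) * (T / (2 * Real.pi) * Real.log T) ≤ zetaZeroCount T := hN.1
      calc |(xiDerivZeroCount 1 T : ℝ) - zetaZeroCount T| ≤ |C| * Real.log T := hb'
        _ = 4 * Real.pi * |C| * T⁻¹ * ((1 - 1 / 2) * (T / (2 * Real.pi) * Real.log T)) := by
          field_simp
          ring
        _ ≤ 4 * Real.pi * |C| * T⁻¹ * zetaZeroCount T :=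
          mul_le_mul_of_nonneg_left hN2 (by positivity)
    have hq' := abs_le.1 hq
  · linarith [hq'.1]
  · linarith [hq'.2]

/-- **At least `(2/3 − ε) N^{(1)}(T)` of the zeros of `ξ′` up to height `T` are on the critical line**,
for every `ε > 0` and all large `T`: `(2/3 − ε/2) N(T) ≤ N^{(1)}₀(T)` (Rolle + [AF26] Theorem A (i),
`eventually_two_thirds_mul_zetaZeroCount_le_xiDerivCriticalZeroCount`), `N^{(1)}(T) ≤ N(T) + C log T`
(Conrey's Lemma 2, `exists_abs_xiDerivZeroCount_sub_zetaZeroCount_le_log`) and `C log T ≤ (ε/2)·¾·N(T)`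
eventually. [cite: Conrey1983, §1 (p. 49) and Lemma 2 (p. 52)] [cite: AlpogeFurman2026, Theorem A (i) and Remark 7.1] -/
theorem eventually_two_thirds_mul_xiDerivZeroCount_le (ε : ℝ) (hε : 0 < ε) :
    ∀ᶠ T : ℝ in atTop, (2 / 3 - ε) * (xiDerivZeroCount 1 T : ℝ) ≤ xiDerivCriticalZeroCount 1 T := by
  rcases le_or_gt (2 / 3 : ℝ) ε with hbig | hsmall
  · filter_upwards with T
    have h0 : (0 : ℝ) ≤ xiDerivCriticalZeroCount 1 T := Nat.cast_nonneg _
    have h1 : (0 : ℝ) ≤ xiDerivZeroCount 1 T := Nat.cast_nonneg _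
    nlinarith
  obtain ⟨C, T₀, hT₀, hC⟩ := exists_abs_xiDerivZeroCount_sub_zetaZeroCount_le_log
  have hA := eventually_two_thirds_mul_zetaZeroCount_le_xiDerivCriticalZeroCount (ε / 2) (by positivity)
  have hmain := AlpogeFurman2026.eventually_zetaZeroCount_near_main (1 / 2) (by norm_num)
  filter_upwards [hA, hmain, eventually_ge_atTop T₀, eventually_gt_atTop (1 : ℝ),
    eventually_ge_atTop (16 * Real.pi * |C| / (3 * ε))] with T hAT hN hT hT1 hTC
  have hπ := Real.pi_pos
  have hL : 0 < Real.log T := Real.log_pos hT1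
  have hb := hC T hT
  have hN₁le : (xiDerivZeroCount 1 T : ℝ) ≤ zetaZeroCount T + |C| * Real.log T := by
    have := (abs_le.1 (hb.trans (mul_le_mul_of_nonneg_right (le_abs_self C) hL.le))).2
    linarith
  have hNlow : (1 - 1 / 2) * (T / (2 * Real.pi) * Real.log T) ≤ zetaZeroCount T := hN.1
  -- `(2/3) |C| log T ≤ (ε/2) N(T)` since `T ≥ 16π|C|/(3ε)`
  have hClog : 2 / 3 * (|C| * Real.log T) ≤ ε / 2 * (zetaZeroCount T : ℝ) := by
    have h1 : 2 / 3 * (|C| * Real.log T) ≤ ε / 2 * ((1 - 1 / 2) * (T / (2 * Real.pi) * Real.log T)) := by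
      rw [div_le_iff₀ (by positivity)] at hTC
      have : 2 / 3 * |C| ≤ ε / 2 * ((1 - 1 / 2) * (T / (2 * Real.pi))) := by
        rw [show ε / 2 * ((1 - 1 / 2) * (T / (2 * Real.pi))) = ε * T / (8 * Real.pi) by ring,
          le_div_iff₀ (by positivity)]
        nlinarith
      nlinarith
    exact h1.trans (mul_le_mul_of_nonneg_left hNlow (by positivity))
  have hc : 0 ≤ 2 / 3 - ε := by linarith
  calc (2 / 3 - ε) * (xiDerivZeroCount 1 T : ℝ)
      ≤ (2 / 3 - ε) * (zetaZeroCount T + |C| * Real.log T) := mul_le_mul_of_nonneg_left hN₁le hc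
    _ ≤ (2 / 3 - ε) * zetaZeroCount T + 2 / 3 * (|C| * Real.log T) := by
        nlinarith [mul_nonneg (abs_nonneg C) hL.le]
    _ ≤ (2 / 3 - ε / 2) * zetaZeroCount T := by linarith
    _ ≤ xiDerivCriticalZeroCount 1 T := hAT

/-- **Unconditionally, `κ′₁ ≥ 2/3`: at least two thirds of the zeros of `ξ′` are on the critical line**
(`xiDerivCriticalLineProportion 1 = liminf_T N^{(1)}₀(T)/N^{(1)}(T) ≥ 2/3`). Inputs: [AF26] Theorem A (i)
(kernel theorem of the tree), Rolle's theorem on the critical line, Conrey's Lemma 2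
(`N^{(1)} = N + O(log T)`). The literature has `κ′₁ ≥ 0.8137` (Conrey 1983, by Levinson's method; the
named fact `conrey1983_xiDeriv_one`, not proved in the tree). [cite: Conrey1983, §1 (p. 49), Corollary (p. 50)]
[cite: AlpogeFurman2026, Theorem A (i) and Remark 7.1] -/
theorem two_thirds_le_xiDerivCriticalLineProportion_one :
    (2 / 3 : ℝ) ≤ xiDerivCriticalLineProportion 1 := by
  refine le_of_forall_pos_lt_add fun ε hε ↦ ?_
  have h := le_xiDerivCriticalLineProportion_one_of_eventually_le
    (eventually_two_thirds_mul_xiDerivZeroCount_le (ε / 2) (by positivity))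
  linarith

end Literature.NumberTheory.LFunctions

end
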